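import Summits.NavierStokesRegularity.NavierStokesRegularity.Theses.RellichScar
import Summits.NavierStokesRegularity.NavierStokesRegularity.Theorems.ScarRigidity.Negative.LogicAndLoadBearing
import Literature.Analysis.FluidPDE.TypeIAncientMild
import Literature.Analysis.FluidPDE.ParasiticSlabFlow
import Literature.Analysis.FluidPDE.KNSSOseenMildDecayOfLemma31
import Literature.Analysis.FluidPDE.KNSSWeakDriftMildProofs
import Literature.Analysis.FluidPDE.KNSSProp41MildHolds
import Literature.Analysis.FluidPDE.KNSSMildRegularity
import Literature.Analysis.FluidPDE.MildL3SmoothOfKNSS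
import Literature.Analysis.FluidPDE.BoundedWeakTranslate
import HarnessLib

/-!
# `ScarRigidity`, line `finite-energy-log-convexity`, stub `stub_apexMildRepresentative` —
# helper file 2: spatially decaying bounded weak solutions on a window are smooth mild solutions

Support file (everything proved) for the stub `stub_apexMildRepresentative` of crux
stmt-NavierStokesRegularity-11717 (route RellichScar). **KNSS 2009, §4 with the mildness clause
of Theorem 6.1 for bounded *weak* solutions**: a bounded weak Navier–Stokes solution `w` on
`ℝ³ × (0, T)` (Koch–Nadirashvili–Seregin–Šverák 2009, §4 (ii)) with the spatial decay
`‖y‖ ‖w(τ, y)‖ ≤ D` agrees a.e. on the window slab with a jointly smooth, divergence-free solution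
`V` of the Oseen integral equation `V(t) = e^{(t−s)Δ}V(s) − B¹_s(V,V)(t)` between all pairs of
times `0 < s < t < T` (`exists_smooth_oseenMild_window`).

Proof. Lemma 3.1 in drift-mild form (`KNSS2009_weak_driftMild_holds`) writes `w = U + b(t)` a.e.
with `U(t) = e^{(t−s)Δ}U(s) − ∫ₛᵗ e^{(t−σ)Δ}P∇·(w ⊗ w) dσ`. The decay kills the drift
(`drift_eq_of_good`, the argument of KNSS 2009, proof of Thm 6.1, last paragraph, here for weak
solutions): at two good times `s₀ < τ` one has, for every `y`,
`b(τ) − b(s₀) = (U(τ, y) + b(τ)) − e^{(τ−s₀)Δ}w(s₀)(y) + B¹_{s₀}(w,w)(τ)(y)`, and along `y = n e₀`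
all three terms tend to `0` (the first is continuous and decays a.e., hence everywhere; the
caloric and Duhamel terms by dominated convergence of the translates). So `b` is a.e. equal to a
constant `β`, `V = U + β` is drift-mild with zero drift, hence jointly smooth by Prop. 4.1
(`KNSS2009_prop41_mild_holds`), divergence free, and Oseen-mild.
-/

noncomputable section

open Set Filter Function MeasureTheory Metric TopologicalSpace
open scoped Topology ENNReal NNReal InnerProductSpace RealInnerProductSpace
open Literature.Analysis Literature.Analysis.FluidPDE
open Summit.NavierStokesRegularity.NavierStokesRegularity.Theses.RellichScar
open Summit.NavierStokesRegularity.NavierStokesRegularity.Theorems.ScarRigidity.Negative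

set_option linter.dupNamespace false

namespace Summit.NavierStokesRegularity.NavierStokesRegularity.Theorems.RellichScarScarRigidity

/-! ## Elementary lemmas -/

variable {E : Type*} [NormedAddCommGroup E] [InnerProductSpace ℝ E] [FiniteDimensional ℝ E]
  [MeasurableSpace E] [BorelSpace E]

omit [FiniteDimensional ℝ E] [MeasurableSpace E] [BorelSpace E] in
/-- **Translates of a spatially decaying field tend to zero**: if `‖y‖ ‖g(y)‖ ≤ D` and `e` is a
unit vector then `g(y + n e) → 0` as `n → ∞` (since `‖y + n e‖ ≥ n − ‖y‖`). [folklore] -/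
theorem tendsto_translate_of_norm_mul_norm_le {F : Type*} [NormedAddCommGroup F] {g : E → F}
    {D : ℝ} (hD : ∀ y, ‖y‖ * ‖g y‖ ≤ D) {e : E} (he1 : ‖e‖ = 1) (y : E) :
    Tendsto (fun n : ℕ => g (y + (n : ℝ) • e)) atTop (𝓝 0) := by
  have hrad : ∀ n : ℕ, (n : ℝ) - ‖y‖ ≤ ‖y + (n : ℝ) • e‖ := fun n => by
    have h1 : ‖(n : ℝ) • e‖ = n := by rw [norm_smul, he1, mul_one, Real.norm_natCast]
    have h2 := norm_sub_norm_le ((n : ℝ) • e) (y + (n : ℝ) • e)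
    rw [h1, show (n : ℝ) • e - (y + (n : ℝ) • e) = -y by abel, norm_neg] at h2
    linarith
  refine squeeze_zero_norm' ?_ ((tendsto_const_nhds (x := D)).div_atTop
    (tendsto_atTop_add_const_right _ (-‖y‖) tendsto_natCast_atTop_atTop))
  filter_upwards [eventually_gt_atTop (⌈‖y‖⌉₊ : ℕ)] with n hn
  have hn' : ‖y‖ < n := (Nat.le_ceil _).trans_lt (by exact_mod_cast hn)
  have hpos : 0 < (n : ℝ) - ‖y‖ := sub_pos.2 hn'
  rw [show (n : ℝ) + -‖y‖ = (n : ℝ) - ‖y‖ by ring, le_div_iff₀ hpos]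
  calc ‖g (y + (n : ℝ) • e)‖ * ((n : ℝ) - ‖y‖)
      ≤ ‖g (y + (n : ℝ) • e)‖ * ‖y + (n : ℝ) • e‖ :=
        mul_le_mul_of_nonneg_left (hrad n) (norm_nonneg _)
    _ = ‖y + (n : ℝ) • e‖ * ‖g (y + (n : ℝ) • e)‖ := mul_comm _ _
    _ ≤ D := hD _

/-! ## Drift-mild pairs: continuity of the slices, the Duhamel term as `oseenDuhamel` -/

section DriftMild

variable {T N : ℝ} {U : ℝ → E → E} {bd : ℝ → E}

/-- Slices of the velocity part of a drift-mild pair are measurable. [folklore] -/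
theorem measurable_slice_of_driftMild (h : IsKNSSDriftMild T N U bd) (σ : ℝ) : Measurable (U σ) :=
  h.measurable.comp (measurable_const.prodMk measurable_id)

/-- **The drift-Duhamel term is the Oseen–Duhamel term of `U + b`**:
`∫ₛᵗ e^{(t−σ)Δ}P∇·((U + b) ⊗ (U + b)) dσ = B¹_s(U + b, U + b)(t)` (the two realisations of KNSS
(4.3) agree on bounded measurable fields, `driftDuhamel_zero_eq_oseenDuhamel`). [cite: KochNadirashviliSereginSverak2009, §4 (4.3)–(4.4) (arXiv:0709.3599v1 p. 8)] -/
theorem driftDuhamel_eq_oseenDuhamel_add (hE : Module.finrank ℝ E = 3)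
    (h : IsKNSSDriftMild T N U bd) {s t : ℝ} (hs : 0 ≤ s) (hst : s ≤ t) (htT : t ≤ T) (x : E) :
    driftDuhamel U bd s t x =
      oseenDuhamel 1 s (fun σ y => U σ y + bd σ) (fun σ y => U σ y + bd σ) t x := by
  rw [driftDuhamel_congr_ae hst (U' := fun σ y => U σ y + bd σ) (b' := 0)
    (Eventually.of_forall fun σ => Eventually.of_forall fun y => by simp)]
  refine driftDuhamel_zero_eq_oseenDuhamel (N := N + N) hE
    (fun σ _ => (measurable_slice_of_driftMild h σ).add_const _) (fun σ hσ y => ?_) hst x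
  exact (norm_add_le _ _).trans (add_le_add (h.norm_le σ ⟨hs.trans_lt hσ.1, hσ.2.trans_le htT⟩ y)
    (h.norm_drift_le σ))

/-- Joint measurability of `U + b` on every sub-slab. [folklore] -/
theorem aestronglyMeasurable_add_drift (h : IsKNSSDriftMild T N U bd) (S : Set (ℝ × E)) :
    AEStronglyMeasurable (uncurry fun σ y => U σ y + bd σ) (volume.restrict S) :=
  (h.measurable.add (h.measurable_drift.comp measurable_fst)).aestronglyMeasurable

/-- **Slices of the velocity part of a drift-mild pair are continuous**: `U(τ)` is the caloric
extension of the bounded slice `U(τ/2)` minus an Oseen–Duhamel term of the bounded field `U + b`,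
both continuous in `x`. [folklore] -/
theorem continuous_slice_of_driftMild (hE : Module.finrank ℝ E = 3) (h : IsKNSSDriftMild T N U bd)
    {τ : ℝ} (hτ : τ ∈ Ioo 0 T) : Continuous (U τ) := by
  haveI : CompleteSpace E := FiniteDimensional.complete ℝ E
  have hs : 0 < τ / 2 := by linarith [hτ.1]
  have hsτ : τ / 2 < τ := by linarith [hτ.1]
  have hN : 0 ≤ N := h.nonneg
  have hM : ∀ σ ∈ Ioo (τ / 2) T, ∀ y, ‖U σ y + bd σ‖ ≤ N + N := fun σ hσ y =>
    (norm_add_le _ _).trans (add_le_add (h.norm_le σ ⟨hs.trans hσ.1, hσ.2⟩ y) (h.norm_drift_le σ))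
  have heq : U τ = fun y => UnboundedOperators.heatExtension (U (τ / 2)) (τ - τ / 2) y -
      oseenDuhamel 1 (τ / 2) (fun σ y => U σ y + bd σ) (fun σ y => U σ y + bd σ) τ y := by
    funext y
    rw [h.mild (τ / 2) τ hs hsτ hτ.2 y,
      driftDuhamel_eq_oseenDuhamel_add hE h hs.le hsτ.le hτ.2.le y]
  rw [heq]
  refine Continuous.sub ?_ ?_
  · have hLp : MemLp (U (τ / 2)) ∞ volume :=
      memLp_top_of_bound (measurable_slice_of_driftMild h _).aestronglyMeasurable N
        (Eventually.of_forall (h.norm_le _ ⟨hs, hsτ.trans hτ.2⟩))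
    exact (UnboundedOperators.contDiff_heatExtension_holds hLp le_top (sub_pos.2 hsτ)).continuous
  · exact continuous_oseenDuhamel_slice one_pos (by positivity) (aestronglyMeasurable_add_drift h _)
      (aestronglyMeasurable_add_drift h _) hM hM hsτ hτ.2.le

end DriftMild

/-! ## The decay kills the drift -/

/-- **The decay kills the parasitic drift** (KNSS 2009, proof of Thm 6.1, last paragraph, for
bounded weak solutions): if `w = U + b` a.e. on a.e. slice of `(0, T)`, with `(U, b)` drift-mild,
`w` bounded and `‖y‖‖w(τ, y)‖ ≤ D`, then `b(τ) = b(s₀)` for any two good times `s₀ < τ` (times at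
which the slice identity holds): for every `y`,
`b(τ) − b(s₀) = (U(τ,y) + b(τ)) − e^{(τ−s₀)Δ}w(s₀)(y) + B¹_{s₀}(w,w)(τ)(y)`, and along `y = n e₀`
the three terms tend to zero. [cite: KochNadirashviliSereginSverak2009, proof of Thm 6.1, last paragraph (arXiv:0709.3599 p. 12)] -/
theorem drift_eq_of_good (hE : Module.finrank ℝ E = 3) {T N L D : ℝ} {w U : ℝ → E → E} {bd : ℝ → E}
    (hw : IsBoundedWeakNSSolutionOn (Ioo 0 T) isOpen_Ioo 1 w)
    (hL : ∀ τ ∈ Ioo 0 T, ∀ y, ‖w τ y‖ ≤ L) (hD : ∀ τ ∈ Ioo 0 T, ∀ y, ‖y‖ * ‖w τ y‖ ≤ D)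
    (hUb : IsKNSSDriftMild T N U bd)
    (hae : ∀ᵐ σ ∂(volume.restrict (Ioo 0 T)), w σ =ᵐ[volume] fun y => U σ y + bd σ)
    {s₀ τ : ℝ} (hs₀ : s₀ ∈ Ioo 0 T) (hτ : τ ∈ Ioo 0 T) (hlt : s₀ < τ)
    (hs₀G : w s₀ =ᵐ[volume] fun y => U s₀ y + bd s₀)
    (hτG : w τ =ᵐ[volume] fun y => U τ y + bd τ) : bd τ = bd s₀ := by
  haveI : CompleteSpace E := FiniteDimensional.complete ℝ E
  haveI : Nontrivial E := Module.nontrivial_of_finrank_pos (R := ℝ) (by omega)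
  obtain ⟨e, he1⟩ : ∃ e : E, ‖e‖ = 1 := exists_norm_eq E zero_le_one
  set xs : ℕ → E := fun n => (n : ℝ) • e with hxs
  have hL0 : 0 ≤ L := (norm_nonneg _).trans (hL s₀ hs₀ 0)
  have hpos : 0 < τ - s₀ := sub_pos.2 hlt
  have hsub : Ioo s₀ τ ⊆ Ioo 0 T := Ioo_subset_Ioo hs₀.1.le hτ.2.le
  set ub : ℝ → E → E := fun σ y => U σ y + bd σ with hub
  -- (1) the slice `U τ + b τ` is continuous and decays everywhere
  have hΦc : Continuous (ub τ) := (continuous_slice_of_driftMild hE hUb hτ).add continuous_const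
  have hΦdec : ∀ y, ‖y‖ * ‖ub τ y‖ ≤ D := by
    have hae' : ∀ᵐ y ∂(volume : Measure E), ‖y‖ * ‖ub τ y‖ ≤ D := by
      filter_upwards [hτG] with y hy
      have : ub τ y = w τ y := hy.symm
      rw [this]
      exact hD τ hτ y
    have hclosed : IsClosed {y : E | ‖y‖ * ‖ub τ y‖ ≤ D} :=
      isClosed_le (continuous_norm.mul hΦc.norm) continuous_const
    intro y
    by_contra hy
    have hnull : volume {y : E | ¬(‖y‖ * ‖ub τ y‖ ≤ D)} = 0 := ae_iff.1 hae'
    exact (hclosed.isOpen_compl.measure_pos volume ⟨y, hy⟩).ne' hnull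
  have hlim1 : Tendsto (fun n => ub τ (xs n)) atTop (𝓝 0) := by
    simpa only [zero_add] using tendsto_translate_of_norm_mul_norm_le hΦdec he1 0
  -- (2) the caloric term `e^{(τ-s₀)Δ}U(s₀) = e^{(τ-s₀)Δ}w(s₀) - b(s₀)` and its decay
  have hws₀ : AEStronglyMeasurable (w s₀) volume :=
    (((measurable_slice_of_driftMild hUb s₀).add_const (bd s₀)).aestronglyMeasurable).congr
      hs₀G.symm
  have hws₀Lp : MemLp (w s₀) ∞ volume :=
    memLp_top_of_bound hws₀ L (Eventually.of_forall (hL s₀ hs₀))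
  have hheat : ∀ y, UnboundedOperators.heatExtension (U s₀) (τ - s₀) y =
      UnboundedOperators.heatExtension (w s₀) (τ - s₀) y - bd s₀ := by
    intro y
    have h1 : U s₀ =ᵐ[volume] (w s₀ - fun _ => bd s₀) := by
      filter_upwards [hs₀G] with z hz
      rw [Pi.sub_apply, hz, add_sub_cancel_right]
    rw [UnboundedOperators.heatExtension_congr_ae' h1]
    have h2 := congrFun (heatFlow_sub_of_memLp hws₀Lp (memLp_top_const (bd s₀)) le_top (τ - s₀)) y
    rw [heatFlow_of_pos _ hpos, heatFlow_of_pos _ hpos, heatFlow_of_pos _ hpos, Pi.sub_apply,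
      UnboundedOperators.heatExtension_const _ hpos] at h2
    exact h2
  have hlim2 : Tendsto (fun n => UnboundedOperators.heatExtension (w s₀) (τ - s₀) (xs n))
      atTop (𝓝 0) := by
    have h := tendsto_heatExtension_of_tendsto_of_bound (f := fun n z => w s₀ (z + xs n))
      (g := fun _ => (0 : E))
      (fun n => hws₀.comp_quasiMeasurePreserving
        (measurePreserving_add_right volume (xs n)).quasiMeasurePreserving)
      (fun n z => hL s₀ hs₀ _) (fun z => tendsto_translate_of_norm_mul_norm_le (hD s₀ hs₀) he1 z)
      hpos 0
    have h0 : UnboundedOperators.heatExtension (fun _ : E => (0 : E)) (τ - s₀) 0 = 0 := by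
      simp [UnboundedOperators.heatExtension_apply]
    simp only [heatExtension_comp_add_right, zero_add, h0] at h
    exact h
  -- (3) the Duhamel term is `B¹_{s₀}(w, w)(τ)` and decays
  have hdrift : ∀ y, driftDuhamel U bd s₀ τ y = oseenDuhamel 1 s₀ w w τ y := fun y => by
    rw [driftDuhamel_eq_oseenDuhamel_add hE hUb hs₀.1.le hlt.le hτ.2.le y]
    have h1 : ∀ᵐ σ ∂(volume.restrict (Ioo s₀ τ)), ub σ =ᵐ[volume] w σ :=
      (ae_restrict_of_ae_restrict_of_subset hsub hae).mono fun σ hσ => hσ.symm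
    exact oseenDuhamel_congr_ae_ae_slice h1 h1 y
  have hmeas_tr : ∀ c : E, AEStronglyMeasurable (uncurry fun σ y => w σ (y + c))
      (volume.restrict (Ioo s₀ τ ×ˢ (univ : Set E))) := fun c => by
    have h1 := (hw.comp_add_space c).1.mono_measure
      (Measure.restrict_mono (prod_mono hsub Subset.rfl) le_rfl)
    have h2 : (uncurry fun t y => w t (c + y)) = uncurry fun σ y => w σ (y + c) := by
      funext q; simp only [uncurry, add_comm]
    rw [h2] at h1
    exact h1
  have hlim3 : Tendsto (fun n => oseenDuhamel 1 s₀ w w τ (xs n)) atTop (𝓝 0) := by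
    have h0m : AEStronglyMeasurable (uncurry (0 : ℝ → E → E))
        (volume.restrict (Ioo s₀ τ ×ˢ (univ : Set E))) := aestronglyMeasurable_const
    have h := tendsto_oseenDuhamel_of_tendsto_of_bound one_pos hL0 hlt
      (u := fun n σ y => w σ (y + xs n)) (u₀ := 0) (fun n => hmeas_tr (xs n)) h0m
      (fun n σ hσ y => hL σ (hsub hσ) _)
      (fun σ hσ y => by
        simpa only [Pi.zero_apply] using
          tendsto_translate_of_norm_mul_norm_le (hD σ (hsub hσ)) he1 y) 0
    simp only [oseenDuhamel_comp_add_right, zero_add, oseenDuhamel_zero_left, Pi.zero_apply] at h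
    exact h
  -- (4) conclusion
  have hid : ∀ y, ub τ y - UnboundedOperators.heatExtension (w s₀) (τ - s₀) y +
      oseenDuhamel 1 s₀ w w τ y = bd τ - bd s₀ := by
    intro y
    have h := hUb.mild s₀ τ hs₀.1 hlt hτ.2 y
    rw [hheat y, hdrift y] at h
    simp only [hub, h]
    abel
  have hlimΦ : Tendsto (fun n => ub τ (xs n) -
      UnboundedOperators.heatExtension (w s₀) (τ - s₀) (xs n) + oseenDuhamel 1 s₀ w w τ (xs n))
      atTop (𝓝 (0 - 0 + 0)) := (hlim1.sub hlim2).add hlim3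
  rw [sub_zero, add_zero] at hlimΦ
  have h0 : bd τ - bd s₀ = 0 :=
    tendsto_nhds_unique (tendsto_const_nhds.congr fun n => (hid (xs n)).symm) hlimΦ
  exact sub_eq_zero.1 h0

/-! ## The window theorem -/

/-- **Spatially decaying bounded weak solutions on a window are smooth mild solutions, up to a
null set** (KNSS 2009, §4 with the mildness clause of Thm 6.1, for bounded weak solutions): a
bounded weak solution `w` on `ℝ³ × (0, T)` with `‖y‖‖w(τ, y)‖ ≤ D` agrees a.e. on `(0, T) × ℝ³`
with a field `V` which is jointly `C^∞` on `(0, T) × ℝ³`, divergence free, and satisfies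
`V(t, x) = e^{(t−s)Δ}V(s)(x) − B¹_s(V,V)(t)(x)` for all `0 < s < t < T` and all `x`. Lemma 3.1
(`KNSS2009_weak_driftMild_holds`) gives `w = U + b` a.e.; the decay makes `b` a.e. constant
(`drift_eq_of_good`); `V = U + β` is drift-mild with zero drift, hence smooth by Prop. 4.1
(`KNSS2009_prop41_mild_holds`) and Oseen-mild. [cite: KochNadirashviliSereginSverak2009, §4 Prop. 4.1, Lemma 3.1 and proof of Thm 6.1 (arXiv:0709.3599 pp. 7–8, 12)] -/
theorem exists_smooth_oseenMild_window {T L D : ℝ} (hT : 0 < T)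
    {w : ℝ → EuclideanSpace ℝ (Fin 3) → EuclideanSpace ℝ (Fin 3)}
    (hw : IsBoundedWeakNSSolutionOn (Ioo 0 T) isOpen_Ioo 1 w)
    (hL : ∀ τ ∈ Ioo 0 T, ∀ y, ‖w τ y‖ ≤ L) (hD : ∀ τ ∈ Ioo 0 T, ∀ y, ‖y‖ * ‖w τ y‖ ≤ D) :
    ∃ V : ℝ → EuclideanSpace ℝ (Fin 3) → EuclideanSpace ℝ (Fin 3), IsSmoothSpaceTimeOn (Ioo 0 T) V ∧
      (∀ t ∈ Ioo 0 T, VectorCalculus.IsDivFree (V t)) ∧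
      (∀ s t : ℝ, 0 < s → s < t → t < T → ∀ x,
        V t x = UnboundedOperators.heatExtension (V s) (t - s) x - oseenDuhamel 1 s V V t x) ∧
      uncurry V =ᵐ[volume.restrict (Ioo 0 T ×ˢ (univ : Set (EuclideanSpace ℝ (Fin 3))))]
        uncurry w := by
  have hE : Module.finrank ℝ (EuclideanSpace ℝ (Fin 3)) = 3 := finrank_euclideanSpace_fin
  -- Lemma 3.1
  obtain ⟨N, hN⟩ := KNSS2009_weak_driftMild_holds L T hT
  obtain ⟨U, bd, hUb, hae⟩ := hN hw hL
  have hN0 : 0 ≤ N := hUb.nonneg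
  have hgood : ∀ᵐ σ ∂(volume.restrict (Ioo 0 T)),
      σ ∈ Ioo 0 T ∧ (w σ =ᵐ[volume] fun y => U σ y + bd σ) :=
    (ae_restrict_mem measurableSet_Ioo).and hae
  haveI hne : NeBot (ae (volume.restrict (Ioo (0 : ℝ) T))) := by
    rw [ae_neBot, Ne, Measure.restrict_eq_zero, Real.volume_Ioo, ENNReal.ofReal_eq_zero, not_le]
    linarith
  obtain ⟨s₀, hs₀, hs₀G⟩ := hgood.exists
  -- the drift is a.e. the constant `β`
  set β : EuclideanSpace ℝ (Fin 3) := bd s₀ with hβ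
  have hconst : ∀ σ ∈ Ioo 0 T, (w σ =ᵐ[volume] fun y => U σ y + bd σ) → bd σ = β := by
    intro σ hσ hσG
    rcases lt_trichotomy s₀ σ with h | h | h
    · exact drift_eq_of_good hE hw hL hD hUb hae hs₀ hσ h hs₀G hσG
    · rw [hβ, h]
    · exact (drift_eq_of_good hE hw hL hD hUb hae hσ hs₀ h hσG hs₀G).symm
  set V : ℝ → EuclideanSpace ℝ (Fin 3) → EuclideanSpace ℝ (Fin 3) := fun σ y => U σ y + β with hV
  have hUslice := measurable_slice_of_driftMild hUb
  -- `V` is drift-mild with zero drift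
  have hVK : IsKNSSDriftMild T (N + N) V 0 := by
    refine IsKNSSDriftMild.mk measurable_const
      (fun t => by simp only [Pi.zero_apply, norm_zero]; positivity)
      (hUb.measurable.add_const β) (fun t ht x => ?_) ?_ (fun s t hs hst htT x => ?_)
    · exact (norm_add_le _ _).trans (add_le_add (hUb.norm_le t ht x) (hUb.norm_drift_le s₀))
    · filter_upwards [hUb.ae_isWeaklyDivFree, ae_restrict_mem measurableSet_Ioo] with t ht htI
      have hLp : MemLp (U t) ∞ volume := memLp_top_of_bound (hUslice t).aestronglyMeasurable N
        (Eventually.of_forall (hUb.norm_le t htI))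
      exact ht.add_of_memLp' le_top le_top (isWeaklyDivFree_const β) hLp (memLp_top_const β)
    · have hpos : 0 < t - s := sub_pos.2 hst
      have h := hUb.mild s t hs hst htT x
      have hUs : MemLp (U s) ∞ volume := memLp_top_of_bound (hUslice s).aestronglyMeasurable N
        (Eventually.of_forall (hUb.norm_le s ⟨hs, hst.trans htT⟩))
      have hVs : MemLp (V s) ∞ volume := hUs.add (memLp_top_const β)
      have hheat : UnboundedOperators.heatExtension (U s) (t - s) x =
          UnboundedOperators.heatExtension (V s) (t - s) x - β := by
        have h2 := congrFun (heatFlow_sub_of_memLp hVs (memLp_top_const β) le_top (t - s)) x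
        have h3 : (V s - fun _ => β) = U s := by funext y; simp [hV]
        rw [h3, heatFlow_of_pos _ hpos, heatFlow_of_pos _ hpos, heatFlow_of_pos _ hpos,
          Pi.sub_apply, UnboundedOperators.heatExtension_const _ hpos] at h2
        exact h2
      have hdrift : driftDuhamel U bd s t x = driftDuhamel V 0 s t x := by
        refine driftDuhamel_congr_ae hst.le ?_ x
        have hsub : Ioo s t ⊆ Ioo 0 T := Ioo_subset_Ioo hs.le htT.le
        filter_upwards [ae_restrict_of_ae_restrict_of_subset hsub hgood] with σ hσ
        refine Eventually.of_forall fun y => ?_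
        simp only [hV, Pi.zero_apply, add_zero, hconst σ hσ.1 hσ.2]
      show U t x + β = _
      rw [h, hheat, hdrift]
      abel
  -- Prop. 4.1: joint smoothness; divergence free; Oseen-mild
  obtain ⟨ε, -, Cst, -, hP⟩ := KNSS2009_prop41_mild_holds 0
  obtain ⟨hsm, -⟩ := hP hVK
  refine ⟨V, hsm,
    fun t ht => isDivFree_of_ae_isWeaklyDivFree_of_smooth hsm hVK.ae_isWeaklyDivFree ht,
    fun s t hs hst htT x => (hVK.eq_heatExtension_sub_oseenDuhamel_three hs hst htT).1 x, ?_⟩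
  -- a.e. equality on the window slab
  have hwP : AEStronglyMeasurable (uncurry w)
      ((volume.restrict (Ioo 0 T)).prod (volume : Measure (EuclideanSpace ℝ (Fin 3)))) := by
    rw [Measure.restrict_prod_eq_prod_univ, ← Measure.volume_eq_prod]
    exact hw.1
  have hslice : ∀ᵐ σ ∂(volume.restrict (Ioo 0 T)),
      ∀ᵐ y ∂(volume : Measure (EuclideanSpace ℝ (Fin 3))),
      (σ, y) ∈ {q : ℝ × EuclideanSpace ℝ (Fin 3) | uncurry V q = hwP.mk (uncurry w) q} := by
    have h1 : ∀ᵐ σ ∂(volume.restrict (Ioo 0 T)),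
        ∀ᵐ y ∂(volume : Measure (EuclideanSpace ℝ (Fin 3))),
        uncurry w (σ, y) = hwP.mk (uncurry w) (σ, y) :=
      Measure.ae_ae_of_ae_prod hwP.ae_eq_mk
    filter_upwards [hgood, h1] with σ hσ h1σ
    filter_upwards [hσ.2, h1σ] with y hy h1y
    rw [← h1y]
    simp only [uncurry_apply_pair, hV, hy, hconst σ hσ.1 hσ.2]
  have hS : MeasurableSet {q : ℝ × EuclideanSpace ℝ (Fin 3) | uncurry V q = hwP.mk (uncurry w) q} :=
    measurableSet_eq_fun hVK.measurable hwP.stronglyMeasurable_mk.measurable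
  have h2 : ∀ᵐ q ∂((volume.restrict (Ioo 0 T)).prod (volume : Measure (EuclideanSpace ℝ (Fin 3)))),
      q ∈ {q : ℝ × EuclideanSpace ℝ (Fin 3) | uncurry V q = hwP.mk (uncurry w) q} :=
    (Measure.ae_prod_mem_iff_ae_ae_mem hS).2 hslice
  rw [Measure.volume_eq_prod, ← Measure.restrict_prod_eq_prod_univ]
  have h3 : uncurry V =ᵐ[(volume.restrict (Ioo 0 T)).prod
      (volume : Measure (EuclideanSpace ℝ (Fin 3)))] hwP.mk (uncurry w) := h2.mono fun q hq => hq
  exact h3.trans hwP.ae_eq_mk.symm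


/-! ## Registered sub-goal (helper stub of `stub_apexMildRepresentative`) -/

/-- **Registered helper stub `stub_apexMildWindowMild`** (sub-goal of `stub_apexMildRepresentative`,
crux stmt-NavierStokesRegularity-11717): a bounded weak Navier–Stokes solution `w` on
`ℝ³ × (0, T)` with the spatial decay `‖y‖‖w(τ, y)‖ ≤ D` agrees a.e. on `(0, T) × ℝ³` with a jointly
smooth, divergence-free solution of the Oseen integral equation between all pairs of times
`0 < s < t < T` (`exists_smooth_oseenMild_window`). [cite: KochNadirashviliSereginSverak2009, §4 Prop. 4.1, Lemma 3.1 and proof of Thm 6.1 (arXiv:0709.3599 pp. 7–8, 12)] -/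
theorem stub_apexMildWindowMild :
    ∀ (T L D : ℝ) (w : ℝ → EuclideanSpace ℝ (Fin 3) → EuclideanSpace ℝ (Fin 3)), 0 < T →
      IsBoundedWeakNSSolutionOn (Ioo 0 T) isOpen_Ioo 1 w →
      (∀ τ ∈ Ioo 0 T, ∀ y : EuclideanSpace ℝ (Fin 3), ‖w τ y‖ ≤ L) →
      (∀ τ ∈ Ioo 0 T, ∀ y : EuclideanSpace ℝ (Fin 3), ‖y‖ * ‖w τ y‖ ≤ D) →
      ∃ V : ℝ → EuclideanSpace ℝ (Fin 3) → EuclideanSpace ℝ (Fin 3), IsSmoothSpaceTimeOn (Ioo 0 T) V ∧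
        (∀ t ∈ Ioo 0 T, VectorCalculus.IsDivFree (V t)) ∧
        (∀ s t : ℝ, 0 < s → s < t → t < T → ∀ x : EuclideanSpace ℝ (Fin 3),
          V t x = Literature.Analysis.UnboundedOperators.heatExtension (V s) (t - s) x - oseenDuhamel 1 s V V t x) ∧
        uncurry V =ᵐ[volume.restrict (Ioo 0 T ×ˢ (univ : Set (EuclideanSpace ℝ (Fin 3))))] uncurry w :=
  fun _ _ _ _ hT hw hL hD => exists_smooth_oseenMild_window hT hw hL hD

end Summit.NavierStokesRegularity.NavierStokesRegularity.Theorems.RellichScarScarRigidity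

end
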